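import Literature.MathematicalPhysics.QuantumFieldTheory.BalabanImbrieJaffe1984to88.BIJ88ConnectedGraphResummation
import Literature.MathematicalPhysics.QuantumFieldTheory.BalabanImbrieJaffe1984to88.BIJ88Clusters5134

/-!
# `BalabanImbrieJaffe1984to88.BIJ88ConnectedGraphFilling` — T. Bałaban, J. Imbrie, A. Jaffe, *Effective action and cluster properties of the
abelian Higgs model*, Commun. Math. Phys. **114** (1988) 257–315 [BalabanImbrieJaffe1988], Sect. 5.14, p. 310 [PDF 54], display 4 and the
sentence defining `W₆^{(k)′}`: *"ℛ_k(Λ^{(k)}_{12}) = Σ_{X⊂Λ^{(k)}_{12}} W₆^{(k)′}(X). Here W₆^{(k)′}(X) is obtained by summing only over {X_γ},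
(Y₁, …, Y_B) which fill X, summing over {γ_j} with suppt(d/dt)_{γ_j} ⊂ X, and integrating over t as in (5.14.2)."* — **THE "FILL X" RESTRICTION
OF THE CONNECTED-GRAPH SUMS OF DISPLAY 3, IN ANY BOOKKEEPING** (the generic half; the sibling `BIJ88W6PrimeVsupp` instantiates it on the
cluster-configuration gas of (5.14.3), i.e. the virtual-support bookkeeping of `BIJ88Expansion5143Ordered`, where p25's gen-5/6 "fill X" objects
`BIJ88W6PrimeBound.term/trunc/W6'` — written for the plain-disjointness bookkeeping `polys R Λ` — are not available).

statement-level skeleton of published theorems with citation tags; proofs where landed; nothing here is a claim about the Yang–Mills mass gap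

PDF held: `paper:balaban1988-cmp114-bij-abelian-higgs-effective-action` (journal page = PDF page + 256); p. 310 = PDF 54 (`p0054.txt` L14–25) read
this generation.

WHAT IS REPRODUCED (unit `lit-balaban-p36`, generation 13 of the Phase-2 proof seat p36, file 2 of the display-4 chain; SKELETON rows **C2.Claim@310** (display 4 /
the definition of `W₆′`, member) and **C2.Eq5.14.5** (member) of `HOME/lit-balaban-r16/ROWS-C2-part2.md`; owner r16, heads untouched; HOME
`run/shared/lean/pub/lit-balaban/`).  Setting of `BIJ88ConnectedGraphResummation` VERBATIM (sites `V`, slots `S`, polymer family `Q`, hard core =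
disjointness, localization `loc : S → V`, activity `w : Finset S → Finset V → ℝ`; `Traw`/`Tord`/`Tsum` = display 3) plus a CUBE PROJECTION
`U : Finset V → Finset κ` (the set of cubes of a cluster; `id` in the plain bookkeeping, `cubesOf` on virtual supports).
* §1 DEFINITIONS (bodies; the printed prescription): **`TrawFill Q loc w U X ι K`** = the raw connected sum of display 3 with the indicator
  *"{X_γ}, (Y₁,…,Y_B) fill X"* (`⋃_i U(Z_i) = X`) inserted; `TordFill` (`/m!`), **`TsumFill`** (the series) — the `X`-piece of the truncated
  function.
* §2 `Traw_eq_sum_TrawFill` / `Tord_eq_sum_TordFill`: the connected sums are the sums of their `X`-pieces over `X ⊆ W` (every cluster has its cubes in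
  `W`); `Tsum_eq_sum_TsumFill` under summability.
* §3 LOCALIZATION `TrawFill_eq_zero_of_not_mem` (*"summing over {γ_j} with suppt(d/dt)_{γ_j} ⊂ X"*: the `X`-piece vanishes unless every slot's
  cube lies in `X`), `TsumFill_eq_zero_of_not_mem`; `Traw_eq_zero_of_not_cov` / `Tsum_eq_zero_of_not_cov` (no cluster contains a slot's site ⇒ the
  connected sums vanish); `cornerSum_congr`, `cornerSum_finset_sum` (plumbing for p25's `cornerSum`).
* §4 **MÖBIUS FORM** — the clusters filling `X` lie inside `X` (`TrawFill_eq_filter`), the connected sum of the SUB-FAMILY of clusters inside `X`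
  is the sum of the pieces of the `X' ⊆ X` (`Traw_filter_eq_sum_TrawFill`), hence by Möbius inversion on the subset lattice (p25's
  `BIJ88Clusters5134.cornerSum_eq_of_forall_sum`) **`TrawFill_eq_cornerSum`** / `TordFill_eq_cornerSum` / **`TsumFill_eq_cornerSum`**: the
  `X`-piece is the corner sum `Σ_{X'⊆X} (−1)^{|X∖X'|} T[Q|_{X'}]` of the truncated functions of the sub-families; `summable_TordFill`,
  `Tsum_filter_eq_sum_TsumFill`.
* §5 BOOKKEEPING INVARIANCE `sum_inQ_image`, `rhoT_congr_of_disjoint_iff`, **`Traw_image_congr`** / `Tord_image_congr` / `Tsum_image_congr`: two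
  injective codings `e₁, e₂` of the same cube polymers `P` with the same overlap pattern, the same slot incidences and the same activities give
  the same connected sums (used by the sibling to identify the sub-family of the clusters inside `X'` with the gas of the sub-region `X'`).
(The estimate half — the `X`-pieces bounded with the decay `q^{|X|}` under tree-graph hypotheses — is the sibling `BIJ88ConnectedGraphFillingBound`.)
HONEST SCOPE: finite combinatorics, Möbius inversion and absolutely convergent real series; no statement about the paper beyond the cited
sentences; no estimate, (5.14.4) not used.  3 definitions with bodies (the printed "fill X" pieces), 0 `Prop` facts, 0 `sorry`; imports
`BIJ88ConnectedGraphResummation` (p25 g6) and `BIJ88Clusters5134` (p25 g8, `cornerSum`); modifies nothing.  NOT summit progress; NOT continuum; NOT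
Clay.  Cell `lit-balaban` Phase 2, seat p36 gen 13 (row owner r16, referee ref-5).
-/

noncomputable section

namespace Literature.MathematicalPhysics.QuantumFieldTheory.BalabanImbrieJaffe1984to88.BIJ88ConnectedGraphFilling

open Finset
open Literature.Probability.LatticeModels (hcUrsell)
open Literature.MathematicalPhysics.QuantumFieldTheory.Dimock2011to13.UrsellTreeGraphBound (rhoT overlapGraph)
open BIJ88ConnectedGraphResummation (OWP InQ Cov wprod Traw Tord Tsum Tord_zero exists_carrier carrier_unique)
open BIJ88Clusters5134 (cornerSum sum_powerset_cornerSum cornerSum_eq_of_forall_sum)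

variable {V : Type*} {S : Type*} {κ : Type*} [DecidableEq V] [Fintype V] [DecidableEq S] [Fintype S] [DecidableEq κ]

/-! ## §1 The `X`-pieces: *"summing only over {X_γ}, (Y₁, …, Y_B) which fill X"* -/

section Defs

variable (Q : Finset (Finset V)) (loc : S → V) (w : Finset S → Finset V → ℝ) (U : Finset V → Finset κ)

/-- **The raw connected sum of display 3 restricted to the cluster families FILLING `X`** (p. 310: *"W₆^{(k)′}(X) is obtained by summing only over
{X_γ}, (Y₁, …, Y_B) which fill X"*): the summand of `BIJ88ConnectedGraphResummation.Traw` (ordered labelled families `(H_i, Z_i)_i`, `OWP`, `Z_i ∈ Q`,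
covering, `ρ^T(Z)·Π w(H_i,Z_i)`) with the indicator `⋃_i U(Z_i) = X` of the families whose cubes fill `X` (`U Z` = the cubes of the cluster `Z`).
[cite: BalabanImbrieJaffe1988, p.310 (Sect. 5.14)] -/
def TrawFill (X : Finset κ) (ι : Type*) [Fintype ι] [DecidableEq ι] (K : Finset S) : ℝ :=
  ∑ Hs : ι → Finset S, ∑ Z : ι → Finset V,
    if OWP K Hs ∧ InQ Q Z ∧ Cov loc Hs Z ∧ univ.biUnion (fun i => U (Z i)) = X then (rhoT Z univ : ℝ) * wprod w Hs Z else 0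

/-- the `X`-piece of the `m`-cluster term of display 3 (`1/m!`-weighted ordered families, as `Tord`). [cite: BalabanImbrieJaffe1988, p.310 (Sect. 5.14)] -/
def TordFill (X : Finset κ) (m : ℕ) (K : Finset S) : ℝ := TrawFill Q loc w U X (Fin m) K / (m.factorial : ℝ)

/-- **the `X`-piece of the truncated function of display 3** (the series over the number of clusters; the `t`-integrand of `W₆^{(k)′}(X)` for one
assignment `{γ_j}`). [cite: BalabanImbrieJaffe1988, p.310 (Sect. 5.14)] -/
def TsumFill (X : Finset κ) (K : Finset S) : ℝ := ∑' m, TordFill Q loc w U X m K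

end Defs

variable (Q : Finset (Finset V)) (loc : S → V) (w : Finset S → Finset V → ℝ) (U : Finset V → Finset κ)

/-! ## §2 The connected sums are the sums of their `X`-pieces -/

/-- **`T_raw = Σ_{X ⊆ W} T_raw^{fill X}`**: if every cluster of `Q` has its cubes in `W`, the raw connected sum is the sum over `X ⊆ W` of its
`X`-pieces (each labelled family fills exactly the union of its cubes). [cite: BalabanImbrieJaffe1988, p.310 (Sect. 5.14)] -/
theorem Traw_eq_sum_TrawFill {W : Finset κ} (hU : ∀ Z ∈ Q, U Z ⊆ W) (ι : Type*) [Fintype ι] [DecidableEq ι] (K : Finset S) :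
    Traw Q loc w ι K = ∑ X ∈ W.powerset, TrawFill Q loc w U X ι K := by
  have key : ∀ (Hs : ι → Finset S) (Z : ι → Finset V),
      (∑ X ∈ W.powerset,
        (if OWP K Hs ∧ InQ Q Z ∧ Cov loc Hs Z ∧ univ.biUnion (fun i => U (Z i)) = X then (rhoT Z univ : ℝ) * wprod w Hs Z else 0)) =
        if OWP K Hs ∧ InQ Q Z ∧ Cov loc Hs Z then (rhoT Z univ : ℝ) * wprod w Hs Z else 0 := by
    intro Hs Z
    by_cases hC : OWP K Hs ∧ InQ Q Z ∧ Cov loc Hs Z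
    · have hmem : univ.biUnion (fun i => U (Z i)) ∈ W.powerset :=
        mem_powerset.2 (biUnion_subset.2 fun i _ => hU _ (hC.2.1 i))
      have h1 : ∀ X ∈ W.powerset,
          (if OWP K Hs ∧ InQ Q Z ∧ Cov loc Hs Z ∧ univ.biUnion (fun i => U (Z i)) = X then (rhoT Z univ : ℝ) * wprod w Hs Z else 0) =
            if univ.biUnion (fun i => U (Z i)) = X then (rhoT Z univ : ℝ) * wprod w Hs Z else 0 := fun X _ => by
        by_cases hX : univ.biUnion (fun i => U (Z i)) = X
        · rw [if_pos ⟨hC.1, hC.2.1, hC.2.2, hX⟩, if_pos hX]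
        · rw [if_neg fun h => hX h.2.2.2, if_neg hX]
      rw [if_pos hC, sum_congr rfl h1, sum_ite_eq, if_pos hmem]
    · rw [if_neg hC]
      exact sum_eq_zero fun X _ => if_neg fun h => hC ⟨h.1, h.2.1, h.2.2.1⟩
  unfold Traw TrawFill
  symm
  calc ∑ X ∈ W.powerset, ∑ Hs : ι → Finset S, ∑ Z : ι → Finset V,
        (if OWP K Hs ∧ InQ Q Z ∧ Cov loc Hs Z ∧ univ.biUnion (fun i => U (Z i)) = X then (rhoT Z univ : ℝ) * wprod w Hs Z else 0)
      = ∑ Hs : ι → Finset S, ∑ X ∈ W.powerset, ∑ Z : ι → Finset V,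
        (if OWP K Hs ∧ InQ Q Z ∧ Cov loc Hs Z ∧ univ.biUnion (fun i => U (Z i)) = X then (rhoT Z univ : ℝ) * wprod w Hs Z else 0) :=
        Finset.sum_comm
    _ = ∑ Hs : ι → Finset S, ∑ Z : ι → Finset V, ∑ X ∈ W.powerset,
        (if OWP K Hs ∧ InQ Q Z ∧ Cov loc Hs Z ∧ univ.biUnion (fun i => U (Z i)) = X then (rhoT Z univ : ℝ) * wprod w Hs Z else 0) :=
        sum_congr rfl fun Hs _ => Finset.sum_comm
    _ = ∑ Hs : ι → Finset S, ∑ Z : ι → Finset V,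
        (if OWP K Hs ∧ InQ Q Z ∧ Cov loc Hs Z then (rhoT Z univ : ℝ) * wprod w Hs Z else 0) :=
        sum_congr rfl fun Hs _ => sum_congr rfl fun Z _ => key Hs Z

/-- degree-wise with the `1/m!` weight. [cite: BalabanImbrieJaffe1988, p.310 (Sect. 5.14)] -/
theorem Tord_eq_sum_TordFill {W : Finset κ} (hU : ∀ Z ∈ Q, U Z ⊆ W) (m : ℕ) (K : Finset S) :
    Tord Q loc w m K = ∑ X ∈ W.powerset, TordFill Q loc w U X m K := by
  unfold Tord TordFill
  rw [Traw_eq_sum_TrawFill Q loc w U hU, sum_div]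

/-- **`T(K) = Σ_{X ⊆ W} T^{fill X}(K)`** for the series, when the `X`-pieces are summable. [cite: BalabanImbrieJaffe1988, p.310 (Sect. 5.14)] -/
theorem Tsum_eq_sum_TsumFill {W : Finset κ} (hU : ∀ Z ∈ Q, U Z ⊆ W) (K : Finset S)
    (hs : ∀ X ∈ W.powerset, Summable fun m => TordFill Q loc w U X m K) :
    Tsum Q loc w K = ∑ X ∈ W.powerset, TsumFill Q loc w U X K := by
  unfold Tsum TsumFill
  rw [show (fun m => Tord Q loc w m K) = fun m => ∑ X ∈ W.powerset, TordFill Q loc w U X m K from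
    funext fun m => Tord_eq_sum_TordFill Q loc w U hU m K]
  exact Summable.tsum_finsetSum hs

/-! ## §3 Localization: *"summing over {γ_j} with suppt(d/dt)_{γ_j} ⊂ X"* -/

/-- **the `X`-piece vanishes unless every slot's cube lies in `X`**: if the cube `cub j` of a slot `j ∈ K` is outside `X` — where a cluster
containing the slot's site `loc j` contains its cube (`hlocU`) — then no family filling `X` covers `K`. [cite: BalabanImbrieJaffe1988, p.310 (Sect. 5.14)] -/
theorem TrawFill_eq_zero_of_not_mem {cub : S → κ} (hlocU : ∀ Z ∈ Q, ∀ j, loc j ∈ Z → cub j ∈ U Z) {X : Finset κ} {K : Finset S}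
    (h : ∃ j ∈ K, cub j ∉ X) (ι : Type*) [Fintype ι] [DecidableEq ι] : TrawFill Q loc w U X ι K = 0 := by
  obtain ⟨j, hj, hjX⟩ := h
  unfold TrawFill
  refine sum_eq_zero fun Hs _ => sum_eq_zero fun Z _ => if_neg ?_
  rintro ⟨howp, hQ, hcov, hfill⟩
  obtain ⟨i, hi⟩ := exists_carrier howp hj
  exact hjX (hfill ▸ mem_biUnion.2 ⟨i, mem_univ _, hlocU _ (hQ i) j (hcov i j hi)⟩)

/-- … hence so do `TordFill` and `TsumFill`. [cite: BalabanImbrieJaffe1988, p.310 (Sect. 5.14)] -/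
theorem TsumFill_eq_zero_of_not_mem {cub : S → κ} (hlocU : ∀ Z ∈ Q, ∀ j, loc j ∈ Z → cub j ∈ U Z) {X : Finset κ} {K : Finset S}
    (h : ∃ j ∈ K, cub j ∉ X) : TsumFill Q loc w U X K = 0 := by
  unfold TsumFill TordFill
  simp only [TrawFill_eq_zero_of_not_mem Q loc w U hlocU h, zero_div, tsum_zero]

/-- **no cluster of the family contains the site of a slot ⇒ the connected sums vanish** (the covering condition cannot be met).
[cite: BalabanImbrieJaffe1988, p.309 (Sect. 5.14)] -/
theorem Traw_eq_zero_of_not_cov {K : Finset S} (h : ∃ j ∈ K, ∀ Z ∈ Q, loc j ∉ Z) (ι : Type*) [Fintype ι] [DecidableEq ι] :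
    Traw Q loc w ι K = 0 := by
  obtain ⟨j, hj, hjQ⟩ := h
  unfold Traw
  refine sum_eq_zero fun Hs _ => sum_eq_zero fun Z _ => if_neg ?_
  rintro ⟨howp, hQ, hcov⟩
  obtain ⟨i, hi⟩ := exists_carrier howp hj
  exact hjQ _ (hQ i) (hcov i j hi)

/-- … the series version. [cite: BalabanImbrieJaffe1988, p.309 (Sect. 5.14)] -/
theorem Tsum_eq_zero_of_not_cov {K : Finset S} (h : ∃ j ∈ K, ∀ Z ∈ Q, loc j ∉ Z) : Tsum Q loc w K = 0 := by
  unfold Tsum Tord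
  simp only [Traw_eq_zero_of_not_cov Q loc w h, zero_div, tsum_zero]

omit [DecidableEq V] [Fintype V] [DecidableEq S] [Fintype S] in
/-- corner sums only see the values on the subsets. [cite: BalabanImbrieJaffe1988, (5.13.3) p.305] -/
theorem cornerSum_congr {F G : Finset κ → ℝ} {X : Finset κ} (h : ∀ X' ⊆ X, F X' = G X') : cornerSum F X = cornerSum G X :=
  sum_congr rfl fun X' hX' => by rw [h X' (mem_powerset.1 hX')]

omit [DecidableEq V] [Fintype V] [DecidableEq S] [Fintype S] in
/-- corner sums commute with finite sums. [cite: BalabanImbrieJaffe1988, (5.13.3) p.305] -/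
theorem cornerSum_finset_sum {β : Type*} (s : Finset β) (F : β → Finset κ → ℝ) (X : Finset κ) :
    cornerSum (fun X' => ∑ b ∈ s, F b X') X = ∑ b ∈ s, cornerSum (F b) X := by
  unfold cornerSum
  rw [sum_comm]
  exact sum_congr rfl fun X' _ => mul_sum _ _ _

/-! ## §4 The Möbius form: the `X`-piece is the corner sum of the truncated functions of the sub-families -/

/-- the families filling `X` consist of clusters INSIDE `X`: the `X`-piece over `Q` is the `X`-piece over the sub-family `Q|_X` of the
clusters with cubes in `X`. [cite: BalabanImbrieJaffe1988, p.310 (Sect. 5.14)] -/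
theorem TrawFill_eq_filter (X : Finset κ) (ι : Type*) [Fintype ι] [DecidableEq ι] (K : Finset S) :
    TrawFill Q loc w U X ι K = TrawFill (Q.filter fun Z => U Z ⊆ X) loc w U X ι K := by
  unfold TrawFill
  refine sum_congr rfl fun Hs _ => sum_congr rfl fun Z _ => ?_
  by_cases hC : OWP K Hs ∧ InQ Q Z ∧ Cov loc Hs Z ∧ univ.biUnion (fun i => U (Z i)) = X
  · have hQ' : InQ (Q.filter fun Z => U Z ⊆ X) Z := fun i =>
      mem_filter.2 ⟨hC.2.1 i, hC.2.2.2 ▸ subset_biUnion_of_mem (fun i => U (Z i)) (mem_univ i)⟩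
    rw [if_pos hC, if_pos ⟨hC.1, hQ', hC.2.2.1, hC.2.2.2⟩]
  · rw [if_neg hC, if_neg fun h => hC ⟨h.1, fun i => (mem_filter.1 (h.2.1 i)).1, h.2.2.1, h.2.2.2⟩]

/-- **the connected sum of the sub-family `Q|_X` is the sum of the `X'`-pieces, `X' ⊆ X`**. [cite: BalabanImbrieJaffe1988, p.310 (Sect. 5.14)] -/
theorem Traw_filter_eq_sum_TrawFill (X : Finset κ) (ι : Type*) [Fintype ι] [DecidableEq ι] (K : Finset S) :
    Traw (Q.filter fun Z => U Z ⊆ X) loc w ι K = ∑ X' ∈ X.powerset, TrawFill Q loc w U X' ι K := by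
  rw [Traw_eq_sum_TrawFill (Q.filter fun Z => U Z ⊆ X) loc w U (W := X) (fun Z hZ => (mem_filter.1 hZ).2) ι K]
  refine sum_congr rfl fun X' hX' => ?_
  rw [TrawFill_eq_filter Q loc w U X', TrawFill_eq_filter (Q.filter fun Z => U Z ⊆ X) loc w U X']
  congr 1
  ext Z
  simp only [mem_filter]
  exact ⟨fun h => ⟨h.1.1, h.2⟩, fun h => ⟨⟨h.1, h.2.trans (mem_powerset.1 hX')⟩, h.2⟩⟩

/-- **MÖBIUS FORM OF THE "FILL X" PRESCRIPTION**: `T_raw^{fill X}(K) = Σ_{X' ⊆ X} (−1)^{|X∖X'|} T_raw[Q|_{X'}](K)` — the `X`-piece is the corner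
sum (`BIJ88Clusters5134.cornerSum`) of the raw connected sums of the sub-families of clusters inside the `X' ⊆ X` (Möbius inversion of
`Traw_filter_eq_sum_TrawFill` on the subset lattice). [cite: BalabanImbrieJaffe1988, p.310 (Sect. 5.14)] -/
theorem TrawFill_eq_cornerSum (X : Finset κ) (ι : Type*) [Fintype ι] [DecidableEq ι] (K : Finset S) :
    TrawFill Q loc w U X ι K = cornerSum (fun X' => Traw (Q.filter fun Z => U Z ⊆ X') loc w ι K) X :=
  (cornerSum_eq_of_forall_sum (W := X) (fun Γ _ => Traw_filter_eq_sum_TrawFill Q loc w U Γ ι K) X Subset.rfl).symm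

/-- degree-wise with the `1/m!` weight. [cite: BalabanImbrieJaffe1988, p.310 (Sect. 5.14)] -/
theorem TordFill_eq_cornerSum (X : Finset κ) (m : ℕ) (K : Finset S) :
    TordFill Q loc w U X m K = cornerSum (fun X' => Tord (Q.filter fun Z => U Z ⊆ X') loc w m K) X := by
  unfold TordFill Tord cornerSum
  rw [TrawFill_eq_cornerSum, cornerSum, sum_div]
  exact sum_congr rfl fun X' _ => by ring

/-- summability of the `X`-pieces from the summability of the connected series of the sub-families. [cite: BalabanImbrieJaffe1988, p.310 (Sect. 5.14)] -/
theorem summable_TordFill {X : Finset κ} {K : Finset S}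
    (hs : ∀ X' ⊆ X, Summable fun m => Tord (Q.filter fun Z => U Z ⊆ X') loc w m K) :
    Summable fun m => TordFill Q loc w U X m K := by
  rw [show (fun m => TordFill Q loc w U X m K) =
      fun m => ∑ X' ∈ X.powerset, (-1 : ℝ) ^ (X \ X').card * Tord (Q.filter fun Z => U Z ⊆ X') loc w m K from
    funext fun m => TordFill_eq_cornerSum Q loc w U X m K]
  exact summable_sum fun X' hX' => (hs X' (mem_powerset.1 hX')).mul_left _

/-- **`T^{fill X}(K) = Σ_{X' ⊆ X} (−1)^{|X∖X'|} T[Q|_{X'}](K)`** for the series: the `X`-piece of the truncated function is the corner sum of the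
truncated functions of the sub-families of the clusters inside the `X' ⊆ X` (their connected series being summable).
[cite: BalabanImbrieJaffe1988, p.310 (Sect. 5.14)] -/
theorem TsumFill_eq_cornerSum {X : Finset κ} {K : Finset S}
    (hs : ∀ X' ⊆ X, Summable fun m => Tord (Q.filter fun Z => U Z ⊆ X') loc w m K) :
    TsumFill Q loc w U X K = cornerSum (fun X' => Tsum (Q.filter fun Z => U Z ⊆ X') loc w K) X := by
  unfold TsumFill Tsum cornerSum
  rw [show (fun m => TordFill Q loc w U X m K) =
      fun m => ∑ X' ∈ X.powerset, (-1 : ℝ) ^ (X \ X').card * Tord (Q.filter fun Z => U Z ⊆ X') loc w m K from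
    funext fun m => TordFill_eq_cornerSum Q loc w U X m K]
  rw [Summable.tsum_finsetSum fun X' hX' => (hs X' (mem_powerset.1 hX')).mul_left _]
  exact sum_congr rfl fun X' _ => tsum_mul_left

/-- **`T[Q|_X](K) = Σ_{X' ⊆ X} T^{fill X'}(K)`** for the series (the connected series of all sub-families summable).
[cite: BalabanImbrieJaffe1988, p.310 (Sect. 5.14)] -/
theorem Tsum_filter_eq_sum_TsumFill {X : Finset κ} {K : Finset S}
    (hs : ∀ X' ⊆ X, Summable fun m => Tord (Q.filter fun Z => U Z ⊆ X') loc w m K) :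
    Tsum (Q.filter fun Z => U Z ⊆ X) loc w K = ∑ X' ∈ X.powerset, TsumFill Q loc w U X' K := by
  rw [← sum_powerset_cornerSum (fun X' => Tsum (Q.filter fun Z => U Z ⊆ X') loc w K) X]
  exact sum_congr rfl fun X' hX' =>
    (TsumFill_eq_cornerSum Q loc w U fun X'' hX'' => hs X'' (hX''.trans (mem_powerset.1 hX'))).symm

omit [DecidableEq V] [Fintype V] in
/-- the whole family is its own sub-family over any `W` containing all its cubes. [cite: BalabanImbrieJaffe1988, p.310 (Sect. 5.14)] -/
theorem filter_subset_eq_self {W : Finset κ} (hU : ∀ Z ∈ Q, U Z ⊆ W) : (Q.filter fun Z => U Z ⊆ W) = Q :=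
  filter_true_of_mem hU

/-! ## §5 Bookkeeping invariance: two codings of the same polymers with the same overlaps, incidences and activities -/

section Invariance

variable {β : Type*}

omit [Fintype V] [DecidableEq S] [Fintype S] [DecidableEq κ] in
/-- re-indexing the cluster tuples of an image family `P.image e` (`e` injective on `P`) by the tuples of `P`.
[cite: BalabanImbrieJaffe1988, p.310 (Sect. 5.14)] -/
theorem sum_inQ_image [Fintype V] (P : Finset β) (e : β → Finset V) (hinj : Set.InjOn e P) {ι : Type*} [Fintype ι] [DecidableEq ι]
    (F : (ι → Finset V) → ℝ) :
    ∑ Z : ι → Finset V, (if InQ (P.image e) Z then F Z else 0) = ∑ Y ∈ Fintype.piFinset (fun _ : ι => P), F (e ∘ Y) := by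
  classical
  have hinj' : Set.InjOn (fun Y : ι → β => e ∘ Y) (Fintype.piFinset fun _ : ι => P) := by
    intro Y hY Y' hY' h
    funext i
    exact hinj (Fintype.mem_piFinset.1 (mem_coe.1 hY) i) (Fintype.mem_piFinset.1 (mem_coe.1 hY') i) (congrFun h i)
  rw [← sum_image hinj', ← sum_filter]
  refine sum_congr ?_ fun _ _ => rfl
  ext Z
  simp only [mem_filter, mem_univ, true_and, mem_image, Fintype.mem_piFinset]
  constructor
  · intro hZ
    choose Y hYP hYe using fun i => mem_image.1 (hZ i)
    exact ⟨Y, hYP, funext hYe⟩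
  · rintro ⟨Y, hY, rfl⟩ i
    exact mem_image_of_mem e (hY i)

omit [Fintype V] [DecidableEq S] [Fintype S] [DecidableEq κ] in
/-- `ρ^T` depends on the clusters only through their overlap graph (it is the hard-core Ursell coefficient of that graph).
[cite: BalabanImbrieJaffe1988, p.310 (Sect. 5.14)] -/
theorem rhoT_congr_of_disjoint_iff {ι : Type*} [DecidableEq ι] {Z Z' : ι → Finset V}
    (h : ∀ i j, Disjoint (Z i) (Z j) ↔ Disjoint (Z' i) (Z' j)) (I : Finset ι) : rhoT Z I = rhoT Z' I := by
  have hG : overlapGraph Z = overlapGraph Z' := by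
    funext i j
    simp only [overlapGraph, h i j]
  have key : ∀ (G G' : ι → ι → Prop) (d : DecidableRel G) (d' : DecidableRel G'), G = G' →
      @hcUrsell ι _ G d I = @hcUrsell ι _ G' d' I := by
    intro G G' d d' hGG'
    subst hGG'
    congr
  exact key _ _ _ _ hG

/-- **BOOKKEEPING INVARIANCE OF THE CONNECTED SUMS**: if `e₁, e₂` code the cube polymers of `P` injectively as clusters in `V` with the same
overlap pattern (`hdisj`), the same incidence of the slot sites (`hloc`, localizations `loc₁`, `loc₂`) and the same activities (`hw`), then the raw
connected sums over the families `P.image e₁`, `P.image e₂` agree. [cite: BalabanImbrieJaffe1988, p.310 (Sect. 5.14)] -/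
theorem Traw_image_congr (P : Finset β) {e₁ e₂ : β → Finset V} (h₁ : Set.InjOn e₁ P) (h₂ : Set.InjOn e₂ P)
    {loc₁ loc₂ : S → V} {w₁ w₂ : Finset S → Finset V → ℝ}
    (hdisj : ∀ Y ∈ P, ∀ Y' ∈ P, Disjoint (e₁ Y) (e₁ Y') ↔ Disjoint (e₂ Y) (e₂ Y'))
    (hloc : ∀ Y ∈ P, ∀ j : S, loc₁ j ∈ e₁ Y ↔ loc₂ j ∈ e₂ Y) (hw : ∀ Y ∈ P, ∀ H : Finset S, w₁ H (e₁ Y) = w₂ H (e₂ Y))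
    (ι : Type*) [Fintype ι] [DecidableEq ι] (K : Finset S) :
    Traw (P.image e₁) loc₁ w₁ ι K = Traw (P.image e₂) loc₂ w₂ ι K := by
  classical
  have hsplit : ∀ (e : β → Finset V) (lc : S → V) (wt : Finset S → Finset V → ℝ) (Hs : ι → Finset S) (Z : ι → Finset V),
      (if OWP K Hs ∧ InQ (P.image e) Z ∧ Cov lc Hs Z then (rhoT Z univ : ℝ) * wprod wt Hs Z else 0) =
        if InQ (P.image e) Z then (if OWP K Hs ∧ Cov lc Hs Z then (rhoT Z univ : ℝ) * wprod wt Hs Z else 0) else 0 := by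
    intro e lc wt Hs Z
    by_cases hQ : InQ (P.image e) Z
    · rw [if_pos hQ]
      by_cases h : OWP K Hs ∧ Cov lc Hs Z
      · rw [if_pos ⟨h.1, hQ, h.2⟩, if_pos h]
      · rw [if_neg fun h' => h ⟨h'.1, h'.2.2⟩, if_neg h]
    · rw [if_neg hQ, if_neg fun h' => hQ h'.2.1]
  unfold Traw
  refine sum_congr rfl fun Hs _ => ?_
  simp only [hsplit]
  rw [sum_inQ_image P e₁ h₁, sum_inQ_image P e₂ h₂]
  refine sum_congr rfl fun Y hY => ?_
  have hYP : ∀ i, Y i ∈ P := fun i => Fintype.mem_piFinset.1 hY i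
  have hcov : Cov loc₁ Hs (e₁ ∘ Y) ↔ Cov loc₂ Hs (e₂ ∘ Y) :=
    ⟨fun h i j hj => (hloc (Y i) (hYP i) j).1 (h i j hj), fun h i j hj => (hloc (Y i) (hYP i) j).2 (h i j hj)⟩
  have hrho : rhoT (e₁ ∘ Y) univ = rhoT (e₂ ∘ Y) univ :=
    rhoT_congr_of_disjoint_iff (fun i j => hdisj (Y i) (hYP i) (Y j) (hYP j)) univ
  have hwp : wprod w₁ Hs (e₁ ∘ Y) = wprod w₂ Hs (e₂ ∘ Y) := by
    unfold wprod
    exact prod_congr rfl fun i _ => hw (Y i) (hYP i) (Hs i)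
  by_cases h : OWP K Hs ∧ Cov loc₁ Hs (e₁ ∘ Y)
  · rw [if_pos h, if_pos ⟨h.1, hcov.1 h.2⟩, hrho, hwp]
  · rw [if_neg h, if_neg fun h' => h ⟨h'.1, hcov.2 h'.2⟩]

/-- … hence the `m`-cluster terms and the series agree. [cite: BalabanImbrieJaffe1988, p.310 (Sect. 5.14)] -/
theorem Tord_image_congr (P : Finset β) {e₁ e₂ : β → Finset V} (h₁ : Set.InjOn e₁ P) (h₂ : Set.InjOn e₂ P)
    {loc₁ loc₂ : S → V} {w₁ w₂ : Finset S → Finset V → ℝ}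
    (hdisj : ∀ Y ∈ P, ∀ Y' ∈ P, Disjoint (e₁ Y) (e₁ Y') ↔ Disjoint (e₂ Y) (e₂ Y'))
    (hloc : ∀ Y ∈ P, ∀ j : S, loc₁ j ∈ e₁ Y ↔ loc₂ j ∈ e₂ Y) (hw : ∀ Y ∈ P, ∀ H : Finset S, w₁ H (e₁ Y) = w₂ H (e₂ Y))
    (m : ℕ) (K : Finset S) : Tord (P.image e₁) loc₁ w₁ m K = Tord (P.image e₂) loc₂ w₂ m K := by
  unfold Tord
  rw [Traw_image_congr P h₁ h₂ hdisj hloc hw]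

/-- … and the truncated functions agree. [cite: BalabanImbrieJaffe1988, p.310 (Sect. 5.14)] -/
theorem Tsum_image_congr (P : Finset β) {e₁ e₂ : β → Finset V} (h₁ : Set.InjOn e₁ P) (h₂ : Set.InjOn e₂ P)
    {loc₁ loc₂ : S → V} {w₁ w₂ : Finset S → Finset V → ℝ}
    (hdisj : ∀ Y ∈ P, ∀ Y' ∈ P, Disjoint (e₁ Y) (e₁ Y') ↔ Disjoint (e₂ Y) (e₂ Y'))
    (hloc : ∀ Y ∈ P, ∀ j : S, loc₁ j ∈ e₁ Y ↔ loc₂ j ∈ e₂ Y) (hw : ∀ Y ∈ P, ∀ H : Finset S, w₁ H (e₁ Y) = w₂ H (e₂ Y))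
    (K : Finset S) : Tsum (P.image e₁) loc₁ w₁ K = Tsum (P.image e₂) loc₂ w₂ K := by
  unfold Tsum
  exact tsum_congr fun m => Tord_image_congr P h₁ h₂ hdisj hloc hw m K

end Invariance

end Literature.MathematicalPhysics.QuantumFieldTheory.BalabanImbrieJaffe1984to88.BIJ88ConnectedGraphFilling

end
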